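import Summits.CriticalPhenomena.PercolationContinuityZ3.Theorems.Transplant.PlanarSkeletonFrmFromDefs
import Summits.CriticalPhenomena.PercolationContinuityZ3.Theorems.Transplant.SkelFrmFromBChoiceRegionsYV
import Summits.CriticalPhenomena.PercolationContinuityZ3.Theorems.Transplant.SkelFrmBChoiceRegionsYV
import Summits.CriticalPhenomena.PercolationContinuityZ3.Theorems.Transplant.SkelFrmFromBChoiceRoomV
import Summits.CriticalPhenomena.PercolationContinuityZ3.Theorems.Transplant.SkelFrmBChoiceRoomV
import HarnessLib
import Summits.CriticalPhenomena.PercolationContinuityZ3.Theorems.Transplant.SkelFrmBChoiceRegionsYVR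
/-!
# U-WAVE PORT (RULING D-U, lead g21 2026-08-26; WAVE-U-MANIFEST v3.0 row «SkelFrmBChoiceRegionsYVR» ↦ «SkelFrmFromBChoiceRegionsYVR») of the tree module
# `Transplant/SkelFrmBChoiceRegionsYVR` onto the carrier `PlanarSkeletonFrmFrom` (frames only, cylinders connected from width `ℓ₀` on)

ORIGINAL TITLE: N2 (frames-only node `SamePDropOfSkeletonFrm₁`, OPEN) — (ζ″) under (R-44)/(R-45): `hPRY_V` IN THE ROOM-FIELD FORM p5-g16's V twins consume

builds on p205010 (kernel theorem, internal audit signed; external expert review pending) — nothing in this file uses p205010; NOTHING is claimed about the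
OPEN node U `SamePDropOfSkeletonFrmFrom₁` (nor U_s / the end state).  Lane `prim-bschramm`, seat `prim-hp-8 gen 53 (U-wave port pen, family P-hp8; tool of record = p3-g26 port_u.py)`; helper file
(`--supports stmt-CriticalPhenomena-4575 --as helper`).  PORT RULES r1–r4 of RULING D-U: declaration order and proof texts are those of the original,
byte-identical except (i) the carrier token `PlanarSkeletonFrm ↦ PlanarSkeletonFrmFrom` (binders, `namespace`/`end` lines, qualified names of twinned
declarations), (ii) carrier-FREE declarations of the original (φ-level `Skelφ…` blocks and namespace-only arithmetic residents) are NOT re-declared —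
this file imports the original and `export`s the twin-free residents (POLICY T / treatment (m1)); residents whose statement mentions a twinned
constant are copied, (iii) every carrier-binding declaration keeps its explicit binder `(Φ : PlanarSkeletonFrmFrom G)` in its own signature (r2).  Docstrings and citations are the original's.  Manifest row idx 177 (level 19; flags verbatim|MIXED(m1)); filed by the hp-8 lineage under RULING M-11 (family P-hp8).
-/

open scoped Classical

noncomputable section

namespace Summit.CriticalPhenomena.PercolationContinuityZ3.Theorems.Transplant

namespace PlanarSkeletonFrmFrom

namespace NegB

open Literature.Probability.Percolation Literature.Probability.LatticeModels SimpleGraph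
open SkelConc (Consts)
open Literature.Probability.Percolation.KozmaNitzan.Cells (oth)
open Skelφ (shearUnit kgSL kgSLY kgM₁Y kgM₂Y kgE₁Y kgWm₂Y kgWp₂Y kgA₁Yp kgA₁Ym kgC₂Y dS rdLo rdHi KGYRows)
open TwoAxis.Para (modulus)
open Neg

section RegionsY

variable (κ : Consts) {V : Type} [DecidableEq V] [Countable V] {G : SimpleGraph V} [G.LocallyFinite] (Φ : PlanarSkeletonFrmFrom G) (t : V) (p : unitInterval)
  (D : Skelφ.StepI.DataNS V) (g f mk : ℕ)

/- The tuple's atoms as hygiene-free local notations (they expand syntactically at each use; importers see the expanded terms; `HKᵣ` mentions the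
   binders `hN hg` of the theorem it is used in). -/
set_option hygiene false in local notation "NYᵣ" => kgNYv0 κ Φ t p D g f mk (qxYQ4 κ Φ t p D g f) (WxYQ4 κ Φ t p D g f)
set_option hygiene false in local notation "qYᵣ" => kgqY κ Φ t p D g f (qxYQ4 κ Φ t p D g f)
set_option hygiene false in local notation "WYᵣ" => kgWY κ Φ t p D g f (WxYQ4 κ Φ t p D g f)
set_option hygiene false in local notation "Rᵣ" => kgR κ Φ t p D mk
set_option hygiene false in local notation "nᵣ" => nL κ Φ t p D g f
set_option hygiene false in local notation "ℓᵣ" => ℓL κ Φ t p D g f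
set_option hygiene false in local notation "hᵣ" => hL κ Φ t p D g f
set_option hygiene false in local notation "vᵣ" => vL κ Φ t p D g f
set_option hygiene false in local notation "Uᵣ" => shearUnit (nL κ Φ t p D g f) (hL κ Φ t p D g f)
set_option hygiene false in local notation "Δᵣ" => modulus (nL κ Φ t p D g f) (hL κ Φ t p D g f) (vL κ Φ t p D g f) (vβL κ Φ t p D g f)
set_option hygiene false in local notation "sLᵣ" => kgSL (nL κ Φ t p D g f) (ℓL κ Φ t p D g f) (hL κ Φ t p D g f)
set_option hygiene false in local notation "s0ᵣ" => (((fcellsA κ Φ t p D g f).s 0 : ℕ) : ℤ)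
set_option hygiene false in local notation "s1ᵣ" => (((fcellsA κ Φ t p D g f).s 1 : ℕ) : ℤ)
set_option hygiene false in local notation "r0ᵣ" => (((fcellsA κ Φ t p D g f).r 0 : ℕ) : ℤ)
set_option hygiene false in local notation "r1ᵣ" => (((fcellsA κ Φ t p D g f).r 1 : ℕ) : ℤ)
set_option hygiene false in local notation "Kᵣ" => ((Neg.K κ : ℕ) : ℤ)
set_option hygiene false in local notation "kqᵣ" => ((Neg.Kq κ : ℕ) : ℤ)
set_option hygiene false in local notation "m1ᵣ" => kgM₁Y (nL κ Φ t p D g f) (vL κ Φ t p D g f) (kgR κ Φ t p D mk) 0 (kgWY κ Φ t p D g f (WxYQ4 κ Φ t p D g f)) (kgNYv0 κ Φ t p D g f mk (qxYQ4 κ Φ t p D g f) (WxYQ4 κ Φ t p D g f))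
set_option hygiene false in local notation "m2ᵣ" => kgM₂Y (nL κ Φ t p D g f) (ℓL κ Φ t p D g f) (hL κ Φ t p D g f) (vL κ Φ t p D g f) (kgR κ Φ t p D mk) 0 (kgqY κ Φ t p D g f (qxYQ4 κ Φ t p D g f)) (kgWY κ Φ t p D g f (WxYQ4 κ Φ t p D g f)) (kgNYv0 κ Φ t p D g f mk (qxYQ4 κ Φ t p D g f) (WxYQ4 κ Φ t p D g f))
set_option hygiene false in local notation "Wm2ᵣ" => kgWm₂Y (nL κ Φ t p D g f) (vL κ Φ t p D g f) (kgR κ Φ t p D mk) 0 (kgWY κ Φ t p D g f (WxYQ4 κ Φ t p D g f)) (kgNYv0 κ Φ t p D g f mk (qxYQ4 κ Φ t p D g f) (WxYQ4 κ Φ t p D g f))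
set_option hygiene false in local notation "Wp2ᵣ" => kgWp₂Y (nL κ Φ t p D g f) (vL κ Φ t p D g f) (kgR κ Φ t p D mk) 0 (kgWY κ Φ t p D g f (WxYQ4 κ Φ t p D g f)) (kgNYv0 κ Φ t p D g f mk (qxYQ4 κ Φ t p D g f) (WxYQ4 κ Φ t p D g f))
set_option hygiene false in local notation "HKᵣ" => kgYRows0_of κ Φ t p D g f mk (qxYQ4 κ Φ t p D g f) (WxYQ4 κ Φ t p D g f) hN hg
set_option hygiene false in local notation "rdLoᵣ" => rdLo (Aof κ) (nL κ Φ t p D g f) (hL κ Φ t p D g f) (vL κ Φ t p D g f) (vβL κ Φ t p D g f) (prFA κ Φ t p D g f).c₀ (prFA κ Φ t p D g f).c₁ (prFA κ Φ t p D g f).D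
set_option hygiene false in local notation "rdHiᵣ" => rdHi (Aof κ) (nL κ Φ t p D g f) (hL κ Φ t p D g f) (vL κ Φ t p D g f) (vβL κ Φ t p D g f) (prFA κ Φ t p D g f).c₀ (prFA κ Φ t p D g f).c₁ (prFA κ Φ t p D g f).D
set_option hygiene false in local notation "L3ᵣ" => ((3 * (nL κ Φ t p D g f * ℓL κ Φ t p D g f) / shearUnit (nL κ Φ t p D g f) (hL κ Φ t p D g f) + 1 : ℕ) : ℤ)
set_option hygiene false in local notation "P0ᵣ" => ((nL κ Φ t p D g f : ℕ) : ℤ) * ℓL κ Φ t p D g f / (shearUnit (nL κ Φ t p D g f) (hL κ Φ t p D g f) : ℕ)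
set_option hygiene false in local notation "dSᵣ" => (((dS (nL κ Φ t p D g f) (ℓL κ Φ t p D g f) (hL κ Φ t p D g f) : ℕ)) : ℤ)
set_option hygiene false in local notation "Apᵣ" => ((kgA₁Yp (nL κ Φ t p D g f) (vL κ Φ t p D g f) (kgR κ Φ t p D mk) (kgWY κ Φ t p D g f (WxYQ4 κ Φ t p D g f)) (kgNYv0 κ Φ t p D g f mk (qxYQ4 κ Φ t p D g f) (WxYQ4 κ Φ t p D g f)) : ℕ) : ℤ)
set_option hygiene false in local notation "Amᵣ" => ((kgA₁Ym (nL κ Φ t p D g f) (vL κ Φ t p D g f) (kgR κ Φ t p D mk) (kgWY κ Φ t p D g f (WxYQ4 κ Φ t p D g f)) (kgNYv0 κ Φ t p D g f mk (qxYQ4 κ Φ t p D g f) (WxYQ4 κ Φ t p D g f)) : ℕ) : ℤ)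
set_option hygiene false in local notation "SCHᵣ" => Skelφ.kgCorrSchedY (HKᵣ).hn (HKᵣ).hv (HKᵣ).hlay ((HKᵣ).kgYVals_ok₁ NYᵣ) ((HKᵣ).kgYVals_ok₂ NYᵣ) ((HKᵣ).kgYVals_split NYᵣ)

/-- **`hPRY_V` IN ROOM-FIELD FORM**: every region of `kgCorrSchedY` lies in a frame box reading inside `[−5r₁+1, 22r₁−1]` along axis 1 and inside the
V cells' signed room `[−hB 1 + 1, hF 1 − 1]` along axis 0, for the cells `fcellsV … c (hFRv … mk)` (any creep value `c`). [this work] -/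
theorem hPRY_V' (κ : Consts) {V : Type} [DecidableEq V] [Countable V] {G : SimpleGraph V} [G.LocallyFinite] (Φ : PlanarSkeletonFrmFrom G) (t : V) (p : unitInterval) (D : Skelφ.StepI.DataNS V) (g : ℕ) (f : ℕ) (mk : ℕ) (c : Fin 2 → ℕ) (hKq : 5 ≤ Neg.Kq κ) (hN : EqNumL κ Φ t p D g f) (hg : gFloorKG κ Φ t p D mk ≤ g) (hg2 : 40 * Neg.K κ * KS0.R'0 κ Φ t p D mk ≤ g) :
    ∀ k ≤ (SCHᵣ).N, ∃ lo hi : Site 2, (SCHᵣ).region k ⊆ Finset.Icc lo hi ∧ (-(5 * r1ᵣ) + 1 ≤ rdLoᵣ lo hi 1 ∧ rdHiᵣ lo hi 1 ≤ 22 * r1ᵣ - 1) ∧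
        (-(((fcellsV κ Φ t p D g f c (hFRv κ Φ t p D g f mk)).hB 1 : ℕ) : ℤ) + 1 ≤ rdLoᵣ lo hi 0 ∧ rdHiᵣ lo hi 0 ≤ (((fcellsV κ Φ t p D g f c (hFRv κ Φ t p D g f mk)).hF 1 : ℕ) : ℤ) - 1) := by
  intro k hk
  obtain ⟨lo, hi, hsub, hrows, ⟨hlo0, -⟩, hhab⟩ := hPRY_V κ Φ t p D g f mk hKq hN hg hg2 k hk
  refine ⟨lo, hi, hsub, hrows, ?_, ?_⟩
  · rw [fcellsV_hB, show oth (1 : Fin 2) = 0 by decide]; push_cast; exact hlo0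
  · rw [fcellsV_hF_eq_hFRv κ Φ t p D g f mk c hKq hN hg hg2 1, (hFRv_apply κ Φ t p D g f mk).2]; push_cast; linarith

end RegionsY

end NegB

end PlanarSkeletonFrmFrom

end Summit.CriticalPhenomena.PercolationContinuityZ3.Theorems.Transplant

end
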